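import Literature.NumberTheory.Automorphic.UnitaryGroupArchCharacterTraceClassOfNuclear
import Literature.NumberTheory.Automorphic.CompactGroupBlockNuclearTraceClass
import Literature.NumberTheory.Automorphic.HarishChandraSpaceDenseProofs
import HarnessLib

/-!
# The trace-class letter for `(ϖ_x ∘ proj_ι)(φ)` REDUCED to Knapp's block estimate over the `K`-irreducible decomposition of `E`

Topic `NumberTheory/Automorphic`; namespace `Literature.NumberTheory.Automorphic.UnitaryGroup` (home of the letter ★ `ArchIntegratedOperatorTraceClass`).  Theorems only
(no definition, no named fact, no instance, no `sorry`).  Cell `hodgecm-mathlib`, line T1a, stub `stub_traceClass` = letter A5 (#91), road HC: sequel of ★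
`UnitaryGroupArchCharacterTraceClassOfNuclear` (node H0′: the letter ⇐ nuclearity along ONE Hilbert basis) and ★ `CompactGroupBlockNuclearTraceClass` (node H2: a bounded
operator with summable block bounds `Σ_W dim W · c_W < ∞` over an irreducible orthogonal decomposition of a unitary representation of a compact group is trace class).

THE REDUCTION.  For a unitary globalization `ϖ` on `E` of a class `x` of `G = U(2,1)` (★ `uFormGroup (Fin 2) (Fin 1)`), the restriction `ϖ|_K` to the compact
group `K = G ∩ U(3)` (★ `RealMatrixGroup.maximalCompact`; compact by ★ `RealMatrixGroup.compactSpace_maximalCompact`) is unitary and strongly continuous, so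
(Peter–Weyl, ★ `exists_irreducible_orthogonal_blocks`) `E = ⊕̂_{W ∈ S} W` over a set `S` of pairwise orthogonal, irreducible, finite-dimensional `K`-blocks.  By ★
`traceClass_clauses_of_forall_decomposition` the three clauses of the letter for `Op := (ϖ ∘ archProjUForm)(φ)` follow from KNAPP'S BLOCK ESTIMATE: block bounds
`‖Op v‖ ≤ c_W ‖v‖ (v ∈ W)` with `Σ_{W ∈ S} dim W · c_W < ∞` — in [Knapp1986, proof of Thm. 10.2] `c_W = ‖(1 + Ω_K)^N φ‖_{L¹} (1 + c(τ_W))^{-N}` and the sum is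
`‖…‖ Σ_τ m_x(τ) d(τ) (1 + c(τ))^{-N} < ∞` by the multiplicity bound [HarishChandra1954] (`m_x(τ) ≤ d(τ)`) and the growth of the Casimir eigenvalues `c(τ)` on `K̂`.

* `archIntegratedOperatorTraceClass_of_blockEstimate` — the letter ★ `ArchIntegratedOperatorTraceClass L ι H T hT νinf` from the block estimate, quantified exactly
  like the letter (every Haar `νinf`, class `x`, globalization `ϖ`, arch-smooth `φ`) and over EVERY irreducible orthogonal `K`-decomposition `S` of `E`.

HONEST LABEL: a reduction, not a discharge — the block estimate (nodes H3 Casimir decay, H4 lattice sum, H5 multiplicity growth of the line card ED. 3) is NOT proved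
here; A5 stays booked (#91).  HC_CM is proved only modulo the 2 remaining named inputs (hLiu418, h413) until rung 0 closes.

## References
* A. W. Knapp, *Representation Theory of Semisimple Groups: An Overview Based on Examples* (1986), Thm. 10.2 and its proof [Knapp1986].
* Harish-Chandra, *Representations of semisimple Lie groups. II*, Trans. AMS 76 (1954) [HarishChandra1954].
* T. Bröcker, T. tom Dieck, *Representations of Compact Lie Groups* (1985), III (5.7) [BrockerTomDieck1985].
-/

set_option autoImplicit false

noncomputable section

open NumberField MeasureTheory CompactlySupported
open Literature.Analysis.OperatorTheory
-- `Classical`: the place subtypes indexing `mixedSpace L` are `Fintype` classically, as in ★ `UnitaryGroupArchCharacterTraceClass` (token-for-token binder match).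
open scoped Matrix InnerProductSpace ENNReal NNReal Classical

namespace Literature.NumberTheory.Automorphic.UnitaryGroup

open Literature.RepresentationTheory.KonnoKonno2007 Literature.RepresentationTheory.KonnoKonno2007.RealDualPair
open Literature.NumberTheory.Rogawski1990 (ArchTestKc)

variable (L : Type) [Field L] [NumberField L] [IsCMField L] (ι : L →+* ℂ) (H : Matrix (Fin 3) (Fin 3) L) (T : GL (Fin 3) ℂ)
  (hT : (T : Matrix (Fin 3) (Fin 3) ℂ)ᴴ * H.map ι * (T : Matrix (Fin 3) (Fin 3) ℂ) = Literature.Geometry.ComplexHyperbolic.BallModel.J)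

/-- **KNAPP THM. 10.2 FOR `G′_∞`, REDUCED TO THE BLOCK ESTIMATE**: if for every Haar `νinf`, every class `x` with unitary globalization `ϖ` on `E`, every
continuous compactly supported archimedean-smooth `φ` and every set `S` of pairwise orthogonal, irreducible, finite-dimensional closed `K`-subrepresentations of
`ϖ|_K` (`K = U(2,1) ∩ U(3)`) with dense sum there are block bounds `c_W` (`‖(ϖ ∘ archProjUForm)(φ) v‖ ≤ c_W ‖v‖` for `v ∈ W`) with `Σ_{W ∈ S} dim W · c_W < ∞`,
then the letter ★ `ArchIntegratedOperatorTraceClass L ι H T hT νinf` holds. [cite: Knapp1986, Thm. 10.2] [cite: BrockerTomDieck1985, III (5.7)] -/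
theorem archIntegratedOperatorTraceClass_of_blockEstimate
    (νinf : @Measure (arch (↥(maximalRealSubfield L)) L (IsCMField.complexConj L) 3 H) (borel _))
    (h : letI : MeasurableSpace (arch (↥(maximalRealSubfield L)) L (IsCMField.complexConj L) 3 H) := borel _
      haveI : BorelSpace (arch (↥(maximalRealSubfield L)) L (IsCMField.complexConj L) 3 H) := ⟨rfl⟩
      ∀ (_hν : νinf.IsHaarMeasure)
        (x : GKIrrClass (uFormGroup (Fin 2) (Fin 1)))
        (E : Type) [NormedAddCommGroup E] [InnerProductSpace ℂ E] [CompleteSpace E]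
        (ϖ : ContRepresentation ℂ (uFormGroup (Fin 2) (Fin 1)).carrier E) (hϖ : IsUnitaryGlobalization (uFormGroup (Fin 2) (Fin 1)) x ϖ)
        (φ : arch (↥(maximalRealSubfield L)) L (IsCMField.complexConj L) 3 H → ℂ) (hφc : Continuous φ) (hφs : HasCompactSupport φ),
        (∃ φ' : GL (Fin 3) (NumberField.mixedEmbedding.mixedSpace L) → ℂ, Continuous φ' ∧ HasCompactSupport φ' ∧
            IsArchSmooth (archGroupGL 3 L).carrier.subtype φ' ∧
            ∀ k : arch (↥(maximalRealSubfield L)) L (IsCMField.complexConj L) 3 H,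
              φ k = φ' (k : GL (Fin 3) (NumberField.mixedEmbedding.mixedSpace L))) →
        ∀ S : Set (ContRepresentation.ClosedSubrep (ϖ.restrict (Subgroup.inclusion (uFormGroup (Fin 2) (Fin 1)).maximalCompact_le_carrier))),
          (∀ W ∈ S, W.toContRep.IsTopIrreducible) → (∀ W ∈ S, FiniteDimensional ℂ W.toSubmodule) →
          OrthogonalFamily ℂ
            (fun W : S => ((W : ContRepresentation.ClosedSubrep
              (ϖ.restrict (Subgroup.inclusion (uFormGroup (Fin 2) (Fin 1)).maximalCompact_le_carrier))).toSubmodule : Submodule ℂ E))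
            (fun W : S => (W : ContRepresentation.ClosedSubrep
              (ϖ.restrict (Subgroup.inclusion (uFormGroup (Fin 2) (Fin 1)).maximalCompact_le_carrier))).toSubmodule.subtypeₗᵢ) →
          (⨆ W : S, (W : ContRepresentation.ClosedSubrep
              (ϖ.restrict (Subgroup.inclusion (uFormGroup (Fin 2) (Fin 1)).maximalCompact_le_carrier))).toSubmodule)ᗮ = ⊥ →
          ∃ c : S → ℝ,
            (∀ W : S, ∀ v ∈ (W : ContRepresentation.ClosedSubrep
                (ϖ.restrict (Subgroup.inclusion (uFormGroup (Fin 2) (Fin 1)).maximalCompact_le_carrier))).toSubmodule,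
              ‖(ϖ.restrict (archProjUForm L ι H T hT)).integratedOperator (hϖ.isUnitary.restrict _)
                  (hϖ.isStronglyContinuous.restrict _ (continuous_archProjUForm L ι H T hT)) νinf ⟨⟨φ, hφc⟩, hφs⟩ v‖ ≤ c W * ‖v‖) ∧
            Summable fun W : S => (Module.finrank ℂ (W : ContRepresentation.ClosedSubrep
                (ϖ.restrict (Subgroup.inclusion (uFormGroup (Fin 2) (Fin 1)).maximalCompact_le_carrier))).toSubmodule : ℝ) * c W) :
    ArchIntegratedOperatorTraceClass L ι H T hT νinf := by
  intro hν x E _ _ _ ϖ hϖ φ hφc hφs hφ' κ b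
  haveI : CompactSpace (uFormGroup (Fin 2) (Fin 1)).maximalCompact := (uFormGroup (Fin 2) (Fin 1)).compactSpace_maximalCompact
  have hincl : Continuous (Subgroup.inclusion (uFormGroup (Fin 2) (Fin 1)).maximalCompact_le_carrier) :=
    continuous_induced_rng.2 continuous_subtype_val
  have hcK : (ϖ.restrict (Subgroup.inclusion (uFormGroup (Fin 2) (Fin 1)).maximalCompact_le_carrier)).IsStronglyContinuous :=
    hϖ.isStronglyContinuous.restrict _ hincl
  have huK : (ϖ.restrict (Subgroup.inclusion (uFormGroup (Fin 2) (Fin 1)).maximalCompact_le_carrier)).IsUnitary :=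
    hϖ.isUnitary.restrict _
  exact traceClass_clauses_of_forall_decomposition hcK huK _ (h hν x E ϖ hϖ φ hφc hφs hφ') κ b

end Literature.NumberTheory.Automorphic.UnitaryGroup

end
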